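import Literature.MathematicalPhysics.QuantumFieldTheory.BalabanImbrieJaffe1984to88.BIJ88EffectiveActionNoncentred308

/-!
# `BalabanImbrieJaffe1984to88.BIJ88GaussShellModulus309` — T. Bałaban, J. Imbrie, A. Jaffe, *Effective action and cluster properties of the abelian
Higgs model*, Commun. Math. Phys. **114** (1988) 257–315 [BalabanImbrieJaffe1988], Sect. 5.14 pp. 308–309 [PDF 52–53]: p. 308 *"replacing
χ(cp(e_k), (I−Q^{s*}Q)A^{(k)}) with χ(cp(te_k), (I−Q^{s*}Q)A^{(k)}), and similarly for χ(cp(e_k), φ^{(k)})"*; p. 309 *"After integration over A^{(k)},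
we obtain factors ct^{−n}e^{−cp(te_k)²} … Similar bounds hold for φ^{(k)}"*; (5.2.1)–(5.2.4) p. 278: the restrictions on the complex scalar field are on
its MODULUS, `χ(λ_k p(e_k), |φ(x)|)`, `χ(p, x) = χ(1, x/p)` — **THE φ^{(k)}-SLOTS: CUT-OFFS IN THE MODULUS OF A (NON-CENTRED) COMPLEX GAUSSIAN**.  This
seat's model theorems (gen 11 `BIJ88EffectiveActionGauss308`, gen 12 `BIJ88EffectiveActionNoncentred308`) take LINEAR slot fields (the components of
`(I − Q_s*Q)A^{(k)}`); the slot field `|φ^{(k)}(x)| = √(Re² + Im²)` is NOT linear and NOT Gaussian.  Here the p. 309 sentence *"Similar bounds hold for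
φ^{(k)}"* is proved for non-centred fields (gen 7's `BIJ88GaussIntegration309Law` §4 did the centred case) and the model theorems are extended to slot
fields that are EITHER linear functionals OR moduli of pairs of linear functionals — both kinds of χ-factor of p. 308.

statement-level skeleton of published theorems with citation tags; proofs where landed; nothing here is a claim about the Yang–Mills mass gap

PDF held: `paper:balaban1988-cmp114-bij-abelian-higgs-effective-action` (journal page = PDF page + 256); p. 278 = PDF 22 (`p0022.txt` L9–23), pp. 308–309
= PDF 52–53 (`p0052.txt` L19–21, `p0053.txt` L25–28) read this generation.

WHAT IS REPRODUCED (unit `lit-balaban-p36`, generation 12 of the Phase-2 proof seat p36, file 6; SKELETON rows **C2.Eq5.14.3-5.14.4** (p. 309 sentence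
for φ^{(k)}, member) and **C2.Eq5.14.1-5.14.2** ((5.14.1)–(5.14.2) at `t = 0` in the model with modulus slots, member) of `HOME/lit-balaban-r16/ROWS-C2-part2.md`,
owner r16, heads untouched; HOME `run/shared/lean/pub/lit-balaban/`).  Theorems only (0 definitions, 0 `Prop` facts):
* §1 `tail_mono`; **`real_sqrt_sq_add_sq_ge_le_of_hasGaussianLaw_meanBound`** — for `X`, `Y` with Gaussian laws of ANY means (`|EX|, |EY| ≤ μ₀`,
  variances `≤ v`; no independence, no joint structure): `P{a ≤ √(X²+Y²)} ≤ 4e^{μ₀²/(2v)}·e^{−a²/(8v)}` for every `a ≥ 0`.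
* §2 THE §5.13 MODEL (`fieldLaw blk Δ ℱ W`, any source `ℱ`): `hasGaussianLaw_linear_fieldLaw`; for a slot field that is a linear functional `ℓ₁` or a
  modulus `√(ℓ₁² + ℓ₂²)` of two linear functionals (`hmod`): `continuous_and_zero_of_mod`, **`tail_slotField_fieldLaw_of_mod`** (sub-Gaussian tail
  `4e^{μ₀²/(2v)}e^{−a²/(8v)}`), **`slotFields_L1_mod`** (the L¹ hypothesis `hL1` of `BIJ88RestrictionsL1Decay308` HOLDS for every finite family of such
  slot fields — `BIJ88GaussShellNoncentred309.tendsto_integral_abs_iteratedDeriv_prod_cutoff_t_zero_of_tail`).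
* §3 **`effectiveAction_fieldLaw_eq_pertP_add_remR_ursell_mod`**, **`effectiveAction_fieldLaw_eq_pertP_add_remR_Tsum_of_ineq5144_mod`**,
  **`abs_effectiveAction_sub_pertP_le_of_ineq5144_mod`** — gen 12's three `hcen`-free model theorems (`BIJ88EffectiveActionNoncentred308` §2) with
  `hlin` (linear slot fields) WEAKENED to `hmod` (linear OR modulus-of-linear slot fields): (5.14.1)–(5.14.2) at the `t = 0` end for BOTH kinds of
  χ-factor of p. 308, no centring.
HONEST SCOPE: (a) a complex field is carried as two real linear functionals of the real site field `α → ℝ` (the tree's §5.13 model is real-valued per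
site; p25's `BIJ88PolymerRep5134Gauss`); (b) constants `1/8`, `4e^{μ₀²/(2v)}` convenient, not optimal; (c) (5.14.4) is the typed leaf, used only in the
last two theorems; (d) `(n̄+1)!` slip GAPS G-C2-p36-06.  0 `sorry`, 0 definitions, 0 new `Prop` facts (D-0026); imports `BIJ88EffectiveActionNoncentred308`
only; modifies nothing.  NOT summit progress; NOT continuum; NOT Clay.  Cell `lit-balaban` Phase 2, seat p36 gen 12 (owner r16, referee ref-5).
-/

noncomputable section

namespace Literature.MathematicalPhysics.QuantumFieldTheory.BalabanImbrieJaffe1984to88.BIJ88GaussShellModulus309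

open Finset MeasureTheory ProbabilityTheory Matrix Filter
open scoped Topology
open Literature.Probability.LatticeModels (ursellOf)
open BIJ88Sect2Statements (pLog)
open BIJ88PolymerRep5134 (corner)
open BIJ88PolymerRep5134Gauss (ext prec src zG)
open BIJ88Expansion5143 (g3 prime)
open BIJ88Expansion5143Gauss (fD)
open BIJ88Expansion5143Ordered (polysOf cvsupp locv wv)
open BIJ88ConnectedGraphResummation (Tsum)
open BIJ88SlotMoments308 (zt slotMoment)
open BIJ88SlotMomentsGauss308 (fieldLaw uD measurable_ext continuous_ext isProbabilityMeasure_fieldLaw zt_fieldLaw_eq_zG zG_fD_empty_pos)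
open BIJ88SlotCumulants308 (ursell_slotMoment_fieldLaw_eq_Tsum_of_ineq5144)
open BIJ88SlotConnectedGraph310KP (abs_remR_sum_Tsum_le_of_ineq5144)
open BIJ88EffectiveActionGauss308 (isGaussian_fieldLaw isLinearMap_ext remR_congr_Ioc)
open BIJ88GaussShellNoncentred309 (real_abs_ge_le_of_hasGaussianLaw_meanBound' tendsto_integral_abs_iteratedDeriv_prod_cutoff_t_zero_of_tail)
open BIJ88EffectiveActionNoncentred308 (effectiveAction_eq_pertP_add_remR_ursell_of_L1)
open BIJ88SlotMoments308 (succ_mul_remR)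
open BIJ88Ineq5113Covering (cubeSys)
open BIJ88Sect5Statements (CutoffProfile cutoff)
open BIJ88Sect5StatementsPart2 (Ineq5144)
open BIJ88Sect5StatementsPart4 (remR pertP)

/-! ## §1 The modulus of a non-centred complex Gaussian: *"Similar bounds hold for φ^{(k)}"* -/

section Tail

variable {Ω : Type*} [MeasurableSpace Ω] {P : Measure Ω}

/-- Monotonicity of the sub-Gaussian tail shape in its two constants. [cite: BalabanImbrieJaffe1988, (5.14.4) p.309] -/
theorem tail_mono {Φ : Ω → ℝ} {A A' κ κ' : ℝ} (h : ∀ a : ℝ, 0 ≤ a → P.real {ω | a ≤ |Φ ω|} ≤ A * Real.exp (-(κ * a ^ 2)))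
    (hA : 0 ≤ A) (hAA : A ≤ A') (hκ : κ' ≤ κ) : ∀ a : ℝ, 0 ≤ a → P.real {ω | a ≤ |Φ ω|} ≤ A' * Real.exp (-(κ' * a ^ 2)) :=
  fun a ha => (h a ha).trans (mul_le_mul hAA (Real.exp_le_exp.mpr (by nlinarith [sq_nonneg a])) (Real.exp_pos _).le (hA.trans hAA))

/-- **Tail of the modulus `|φ| = √(X²+Y²)` of a NON-CENTRED complex Gaussian from the marginal laws only** (p. 309: *"Similar bounds hold for φ^{(k)}"*;
(5.2.1) p. 278: `χ(λ_k p(e_k), |φ(x)|)`): for `X = Re φ`, `Y = Im φ` with Gaussian laws on any probability space (no independence), `|E X|, |E Y| ≤ μ₀`,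
`Var X, Var Y ≤ v` (`0 < v`) and `a ≥ 0`: `P{a ≤ √(X²+Y²)} ≤ 4e^{μ₀²/(2v)}·e^{−a²/(8v)}` (union bound over `{|X| ≥ a/√2}`, `{|Y| ≥ a/√2}` and
`BIJ88GaussShellNoncentred309.real_abs_ge_le_of_hasGaussianLaw_meanBound`). [cite: BalabanImbrieJaffe1988, (5.14.4) p.309] -/
theorem real_sqrt_sq_add_sq_ge_le_of_hasGaussianLaw_meanBound {X Y : Ω → ℝ} (hX : HasGaussianLaw X P) (hY : HasGaussianLaw Y P)
    (hXm : Measurable X) (hYm : Measurable Y) {μ₀ v : ℝ} (hmX : |P[X]| ≤ μ₀) (hmY : |P[Y]| ≤ μ₀) (hv : 0 < v) (hvX : Var[X; P] ≤ v)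
    (hvY : Var[Y; P] ≤ v) {a : ℝ} (ha : 0 ≤ a) :
    P.real {ω | a ≤ Real.sqrt (X ω ^ 2 + Y ω ^ 2)} ≤ 4 * Real.exp (μ₀ ^ 2 / (2 * v)) * Real.exp (-(1 / (8 * v) * a ^ 2)) := by
  haveI := hX.isProbabilityMeasure
  have hsub : {ω | a ≤ Real.sqrt (X ω ^ 2 + Y ω ^ 2)} ⊆ {ω | a / Real.sqrt 2 ≤ |X ω|} ∪ {ω | a / Real.sqrt 2 ≤ |Y ω|} := by
    intro ω hω
    have h := BIJ88GaussIntegration309Phi.sqrt_sq_add_sq_tail_subset a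
      (show (X ω, Y ω) ∈ {q : ℝ × ℝ | a ≤ Real.sqrt (q.1 ^ 2 + q.2 ^ 2)} from hω)
    rcases h with h | h
    · exact Or.inl h.1
    · exact Or.inr h.2
  have ha' : 0 ≤ a / Real.sqrt 2 := by positivity
  have hsq2 : Real.sqrt 2 ^ 2 = 2 := Real.sq_sqrt (by norm_num)
  have e : 1 / (4 * v) * (a / Real.sqrt 2) ^ 2 = 1 / (8 * v) * a ^ 2 := by rw [div_pow, hsq2]; ring
  have hX' := real_abs_ge_le_of_hasGaussianLaw_meanBound' hX hXm hmX hv hvX ha'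
  have hY' := real_abs_ge_le_of_hasGaussianLaw_meanBound' hY hYm hmY hv hvY ha'
  rw [e] at hX' hY'
  calc P.real {ω | a ≤ Real.sqrt (X ω ^ 2 + Y ω ^ 2)}
      ≤ P.real ({ω | a / Real.sqrt 2 ≤ |X ω|} ∪ {ω | a / Real.sqrt 2 ≤ |Y ω|}) := measureReal_mono hsub
    _ ≤ P.real {ω | a / Real.sqrt 2 ≤ |X ω|} + P.real {ω | a / Real.sqrt 2 ≤ |Y ω|} := measureReal_union_le _ _
    _ ≤ 2 * Real.exp (μ₀ ^ 2 / (2 * v)) * Real.exp (-(1 / (8 * v) * a ^ 2)) +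
        2 * Real.exp (μ₀ ^ 2 / (2 * v)) * Real.exp (-(1 / (8 * v) * a ^ 2)) := add_le_add hX' hY'
    _ = 4 * Real.exp (μ₀ ^ 2 / (2 * v)) * Real.exp (-(1 / (8 * v) * a ^ 2)) := by ring

end Tail

/-! ## §2 The §5.13 model: slot fields that are linear functionals or moduli of pairs of linear functionals -/

section Model

variable {α I : Type} [Fintype α] [DecidableEq α] [Fintype I] [DecidableEq I]
  (blk : α → I) (Δ : Matrix α α ℝ) (ℱ : α → ℝ) (W : Finset I)

/-- A linear functional of the field, read on the fields of `W`, has a Gaussian law under `fieldLaw blk Δ ℱ W` (`W`-block of `Δ` positive definite;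
gen 11's `isGaussian_fieldLaw`). [cite: BalabanImbrieJaffe1988, (5.14.3) p.309] -/
theorem hasGaussianLaw_linear_fieldLaw (hPD : (prec blk Δ W (corner ℝ W)).PosDef) {ℓ : (α → ℝ) → ℝ} (hℓ : IsLinearMap ℝ ℓ) :
    HasGaussianLaw (fun ω => ℓ (ext blk W ω)) (fieldLaw blk Δ ℱ W) := by
  haveI := isGaussian_fieldLaw blk Δ ℱ W hPD
  let T : ({x : α // blk x ∈ W} → ℝ) →ₗ[ℝ] ℝ := (hℓ.mk' ℓ).comp ((isLinearMap_ext blk W).mk' _)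
  have hT : (fun ω => ℓ (ext blk W ω)) = ⇑(LinearMap.toContinuousLinearMap T) ∘ id := by
    funext ω
    simp [T]
  rw [hT]
  exact IsGaussian.hasGaussianLaw_id.map _

omit [Fintype α] [DecidableEq α] [Fintype I] [DecidableEq I] in
/-- A slot field that is a linear functional `ℓ₁` or a modulus `√(ℓ₁² + ℓ₂²)` of two linear functionals is continuous and vanishes at the zero field
(the structural inputs of `BIJ88SlotMomentsGauss308.zG_fD_empty_pos`). [cite: BalabanImbrieJaffe1988, (5.14.2) p.308] -/
theorem continuous_and_zero_of_mod [Fintype α] {Φb ℓ₁ ℓ₂ : (α → ℝ) → ℝ} (h₁ : IsLinearMap ℝ ℓ₁) (h₂ : IsLinearMap ℝ ℓ₂)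
    (h : (∀ φ, Φb φ = ℓ₁ φ) ∨ (∀ φ, Φb φ = Real.sqrt (ℓ₁ φ ^ 2 + ℓ₂ φ ^ 2))) : Continuous Φb ∧ Φb 0 = 0 := by
  have hc₁ : Continuous ℓ₁ := LinearMap.continuous_of_finiteDimensional (h₁.mk' ℓ₁)
  have hc₂ : Continuous ℓ₂ := LinearMap.continuous_of_finiteDimensional (h₂.mk' ℓ₂)
  have hz₁ : ℓ₁ 0 = 0 := (h₁.mk' ℓ₁).map_zero
  have hz₂ : ℓ₂ 0 = 0 := (h₂.mk' ℓ₂).map_zero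
  rcases h with h | h
  · have hΦ : Φb = ℓ₁ := funext h
    exact ⟨hΦ ▸ hc₁, by rw [h, hz₁]⟩
  · have hΦ : Φb = fun φ => Real.sqrt (ℓ₁ φ ^ 2 + ℓ₂ φ ^ 2) := funext h
    refine ⟨hΦ ▸ Real.continuous_sqrt.comp ((hc₁.pow 2).add (hc₂.pow 2)), ?_⟩
    rw [h, hz₁, hz₂]; simp

/-- **Sub-Gaussian tail of a linear-or-modulus slot field under the law of (5.14.3)**: for `Φ_b = ℓ₁` or `Φ_b = √(ℓ₁² + ℓ₂²)` with `ℓ₁, ℓ₂` linear, means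
`|E ℓ_i(ext ·)| ≤ μ₀` and variances `≤ v` (`0 < v`) under `fieldLaw blk Δ ℱ W` (`W`-block positive definite), and every `a ≥ 0`:
`fieldLaw{a ≤ |Φ_b ∘ ext|} ≤ 4e^{μ₀²/(2v)}·e^{−a²/(8v)}` (*"Similar bounds hold for φ^{(k)}"*). [cite: BalabanImbrieJaffe1988, (5.14.4) p.309] -/
theorem tail_slotField_fieldLaw_of_mod (hPD : (prec blk Δ W (corner ℝ W)).PosDef) {Φb ℓ₁ ℓ₂ : (α → ℝ) → ℝ} (h₁ : IsLinearMap ℝ ℓ₁)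
    (h₂ : IsLinearMap ℝ ℓ₂) (h : (∀ φ, Φb φ = ℓ₁ φ) ∨ (∀ φ, Φb φ = Real.sqrt (ℓ₁ φ ^ 2 + ℓ₂ φ ^ 2))) {μ₀ v : ℝ}
    (hm₁ : |∫ ω, ℓ₁ (ext blk W ω) ∂(fieldLaw blk Δ ℱ W)| ≤ μ₀) (hm₂ : |∫ ω, ℓ₂ (ext blk W ω) ∂(fieldLaw blk Δ ℱ W)| ≤ μ₀) (hv : 0 < v)
    (hv₁ : Var[fun ω => ℓ₁ (ext blk W ω); fieldLaw blk Δ ℱ W] ≤ v) (hv₂ : Var[fun ω => ℓ₂ (ext blk W ω); fieldLaw blk Δ ℱ W] ≤ v)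
    {a : ℝ} (ha : 0 ≤ a) :
    (fieldLaw blk Δ ℱ W).real {ω | a ≤ |Φb (ext blk W ω)|} ≤ 4 * Real.exp (μ₀ ^ 2 / (2 * v)) * Real.exp (-(1 / (8 * v) * a ^ 2)) := by
  have hG₁ := hasGaussianLaw_linear_fieldLaw blk Δ ℱ W hPD h₁
  have hG₂ := hasGaussianLaw_linear_fieldLaw blk Δ ℱ W hPD h₂
  have hM₁ : Measurable fun ω : {x : α // blk x ∈ W} → ℝ => ℓ₁ (ext blk W ω) :=
    ((LinearMap.continuous_of_finiteDimensional (h₁.mk' ℓ₁)).comp (continuous_ext blk W)).measurable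
  have hM₂ : Measurable fun ω : {x : α // blk x ∈ W} → ℝ => ℓ₂ (ext blk W ω) :=
    ((LinearMap.continuous_of_finiteDimensional (h₂.mk' ℓ₂)).comp (continuous_ext blk W)).measurable
  rcases h with h | h
  · -- linear slot: the non-centred Gaussian tail, with the constants relaxed
    have ht := tail_mono (P := fieldLaw blk Δ ℱ W) (Φ := fun ω => ℓ₁ (ext blk W ω))
      (fun a' ha' => real_abs_ge_le_of_hasGaussianLaw_meanBound' hG₁ hM₁ hm₁ hv hv₁ ha') (by positivity)
      (by nlinarith [Real.exp_pos (μ₀ ^ 2 / (2 * v))] : 2 * Real.exp (μ₀ ^ 2 / (2 * v)) ≤ 4 * Real.exp (μ₀ ^ 2 / (2 * v)))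
      (one_div_le_one_div_of_le (by positivity) (by linarith) : 1 / (8 * v) ≤ 1 / (4 * v)) a ha
    simpa only [h] using ht
  · -- modulus slot
    have hset : {ω : {x : α // blk x ∈ W} → ℝ | a ≤ |Φb (ext blk W ω)|} =
        {ω | a ≤ Real.sqrt (ℓ₁ (ext blk W ω) ^ 2 + ℓ₂ (ext blk W ω) ^ 2)} := by
      ext ω; simp only [Set.mem_setOf_eq, h, abs_of_nonneg (Real.sqrt_nonneg _)]
    rw [hset]
    exact real_sqrt_sq_add_sq_ge_le_of_hasGaussianLaw_meanBound hG₁ hG₂ hM₁ hM₂ hm₁ hm₂ hv hv₁ hv₂ ha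

variable (χ : CutoffProfile) {ι υ : Type*} [DecidableEq ι] [DecidableEq υ]
variable {p ek : ℝ} {B : Finset ι} {Φ : ι → (α → ℝ) → ℝ} {c : ι → ℝ} {Ys : Finset υ} {V : υ → (α → ℝ) → ℝ}
variable (adj : I → I → Prop) [DecidableRel adj] {nbr : I → Finset I} {D : ℕ}
variable (cube : ↥B ⊕ ↥Ys → I) {θ β' : ℝ} {L : Type} [Fintype L] [DecidableEq L]

omit [DecidableEq ι] in
/-- **`hL1` HOLDS IN THE MODEL FOR LINEAR-OR-MODULUS SLOT FIELDS** (both kinds of χ-factor of p. 308: `χ(c p(te_k), (I−Q_s*Q)A^{(k)})` and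
`χ(c p(te_k), |φ^{(k)}|)`): for `Φ_b` each a linear functional or a modulus of two linear functionals (`hmod`), `W`-block of `Δ` positive definite,
`c_b ≥ c₀ > 0`, `p > 1/2`, `e_k > 0`, `i ≥ 1`: `∫ |(∂/∂t)ⁱ Π_b χ(c_b p(te_k), Φ_b(ext ω))| dfieldLaw(ω) → 0` as `t → 0⁺` — uniform tail constants from the
finitely many means and variances, then `BIJ88GaussShellNoncentred309.tendsto_integral_abs_iteratedDeriv_prod_cutoff_t_zero_of_tail`.
[cite: BalabanImbrieJaffe1988, p.309 (Sect. 5.14)] -/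
theorem slotFields_L1_mod (hp : 1 / 2 < p) (hPD : (prec blk Δ W (corner ℝ W)).PosDef)
    (hmod : ∀ b ∈ B, ∃ ℓ₁ ℓ₂ : (α → ℝ) → ℝ, IsLinearMap ℝ ℓ₁ ∧ IsLinearMap ℝ ℓ₂ ∧
      ((∀ φ, Φ b φ = ℓ₁ φ) ∨ (∀ φ, Φ b φ = Real.sqrt (ℓ₁ φ ^ 2 + ℓ₂ φ ^ 2))))
    {c₀ : ℝ} (hc₀ : 0 < c₀) (hcb : ∀ b ∈ B, c₀ ≤ c b) (hek : 0 < ek) :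
    ∀ i, 1 ≤ i → Tendsto (fun t => ∫ ω, |iteratedDeriv i (fun s => ∏ b ∈ B, cutoff χ (c b * pLog p (s * ek)) (Φ b (ext blk W ω))) t|
      ∂(fieldLaw blk Δ ℱ W)) (𝓝[>] (0 : ℝ)) (𝓝 0) := by
  haveI := isProbabilityMeasure_fieldLaw blk Δ ℱ W hPD
  choose! ℓ₁ ℓ₂ hℓ₁ hℓ₂ hΦ using hmod
  intro i hi
  set P := fieldLaw blk Δ ℱ W
  set μ₀ : ℝ := ∑ b ∈ B, (|∫ ω, ℓ₁ b (ext blk W ω) ∂P| + |∫ ω, ℓ₂ b (ext blk W ω) ∂P|) with hμ₀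
  set v : ℝ := 1 + ∑ b ∈ B, (Var[fun ω => ℓ₁ b (ext blk W ω); P] + Var[fun ω => ℓ₂ b (ext blk W ω); P]) with hvdef
  have hvn : ∀ b ∈ B, 0 ≤ Var[fun ω => ℓ₁ b (ext blk W ω); P] + Var[fun ω => ℓ₂ b (ext blk W ω); P] :=
    fun b _ => add_nonneg (variance_nonneg _ _) (variance_nonneg _ _)
  have hv : 0 < v := by have := Finset.sum_nonneg hvn; rw [hvdef]; linarith
  have hmean : ∀ b ∈ B, |∫ ω, ℓ₁ b (ext blk W ω) ∂P| ≤ μ₀ ∧ |∫ ω, ℓ₂ b (ext blk W ω) ∂P| ≤ μ₀ := fun b hb => by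
    have h := Finset.single_le_sum (f := fun b => |∫ ω, ℓ₁ b (ext blk W ω) ∂P| + |∫ ω, ℓ₂ b (ext blk W ω) ∂P|)
      (fun b _ => add_nonneg (abs_nonneg _) (abs_nonneg _)) hb
    exact ⟨le_trans (le_add_of_nonneg_right (abs_nonneg _)) h, le_trans (le_add_of_nonneg_left (abs_nonneg _)) h⟩
  have hvar : ∀ b ∈ B, Var[fun ω => ℓ₁ b (ext blk W ω); P] ≤ v ∧ Var[fun ω => ℓ₂ b (ext blk W ω); P] ≤ v := fun b hb => by
    have h := Finset.single_le_sum hvn hb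
    have h1 := variance_nonneg (fun ω => ℓ₁ b (ext blk W ω)) P
    have h2 := variance_nonneg (fun ω => ℓ₂ b (ext blk W ω)) P
    rw [hvdef]
    exact ⟨by linarith, by linarith⟩
  have hΦm : ∀ b ∈ B, Measurable fun ω : {x : α // blk x ∈ W} → ℝ => Φ b (ext blk W ω) := fun b hb =>
    ((continuous_and_zero_of_mod (hℓ₁ b hb) (hℓ₂ b hb) (hΦ b hb)).1.comp (continuous_ext blk W)).measurable
  exact tendsto_integral_abs_iteratedDeriv_prod_cutoff_t_zero_of_tail χ hp P B hΦm (A := 4 * Real.exp (μ₀ ^ 2 / (2 * v)))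
    (κ := 1 / (8 * v)) (by positivity) (by positivity)
    (fun b hb a ha => tail_slotField_fieldLaw_of_mod blk Δ ℱ W hPD (hℓ₁ b hb) (hℓ₂ b hb) (hΦ b hb) (hmean b hb).1 (hmean b hb).2 hv
      (hvar b hb).1 (hvar b hb).2 ha)
    hc₀ (fun b hb => (hcb b hb).trans (le_abs_self _)) hek hi

/-! ## §3 (5.14.1)–(5.14.2) at the `t = 0` end in the model for both kinds of χ-factor -/

/-- **(5.14.1)–(5.14.2) AT THE `t = 0` END IN THE §5.13 GAUSSIAN MODEL FOR LINEAR-OR-MODULUS SLOT FIELDS, NO CENTRING** (p. 308: *"… and similarly for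
χ(cp(e_k), φ^{(k)}). Thus the restrictions and the interactions disappear at t = 0, at which point we have a purely Gaussian expectation"*): in the law
`fieldLaw blk Δ ℱ W` (`W`-block positive definite, ANY source `ℱ`), for slot fields `Φ_b` each a linear functional or a modulus of two linear functionals
(`hmod`), cubes of the slots in `W`, `χ ≥ 0`, `p > 1/2`, `c_b ≥ c₀ > 0`, measurable bounded terms, `0 < e_k < e^{−1}`, `|L| = n̄+1`:
`−log z₁ = 𝒫̃_{k+1} + (n̄+1)·remR(t ↦ Σ_γ uᵀ_{γ,t}(L))` and the `∫₀¹` form, `z_t = zG blk Δ ℱ (fD_t γ₀ ∅) W W` — gen 12's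
`BIJ88EffectiveActionNoncentred308.effectiveAction_fieldLaw_eq_pertP_add_remR_ursell'` with `hlin` weakened to `hmod`.
[cite: BalabanImbrieJaffe1988, (5.14.1)–(5.14.2) p.308] -/
theorem effectiveAction_fieldLaw_eq_pertP_add_remR_ursell_mod (hχ : ∀ x, 0 ≤ χ.χ₁ x) (hp : 1 / 2 < p)
    (hPD : (prec blk Δ W (corner ℝ W)).PosDef) (hcube : ∀ τ, cube τ ∈ W)
    (hmod : ∀ b ∈ B, ∃ ℓ₁ ℓ₂ : (α → ℝ) → ℝ, IsLinearMap ℝ ℓ₁ ∧ IsLinearMap ℝ ℓ₂ ∧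
      ((∀ φ, Φ b φ = ℓ₁ φ) ∨ (∀ φ, Φ b φ = Real.sqrt (ℓ₁ φ ^ 2 + ℓ₂ φ ^ 2))))
    {c₀ : ℝ} (hc₀ : 0 < c₀) (hcb : ∀ b ∈ B, c₀ ≤ c b) (hV : ∀ Y ∈ Ys, Measurable (V Y)) {KY : υ → ℝ}
    (hK : ∀ Y ∈ Ys, ∀ φ, |V Y φ| ≤ KY Y) (hek : 0 < ek) (hek1 : ek < Real.exp (-1)) {nbar : ℕ} (hL : Fintype.card L = nbar + 1)
    (s₀ : ↥B ⊕ ↥Ys) (γ₀ : L → ↥B ⊕ ↥Ys) :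
    -Real.log (zG blk Δ ℱ (fD (uD χ p ek B Φ c Ys V 1) cube γ₀ ∅) W W) =
        pertP (fun t => Real.log (zG blk Δ ℱ (fD (uD χ p ek B Φ c Ys V t) cube γ₀ ∅) W W)) nbar
          + (nbar + 1 : ℝ) * remR (fun t => ∑ γ : L → ↥B ⊕ ↥Ys, ursellOf (fun K' => slotMoment χ p ek B (fun b ω => Φ b (ext blk W ω)) c Ys
              (fun Y ω => V Y (ext blk W ω)) (fieldLaw blk Δ ℱ W) t K' γ) univ) nbar ∧
      -Real.log (zG blk Δ ℱ (fD (uD χ p ek B Φ c Ys V 1) cube γ₀ ∅) W W) =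
        pertP (fun t => Real.log (zG blk Δ ℱ (fD (uD χ p ek B Φ c Ys V t) cube γ₀ ∅) W W)) nbar
          + ∫ t in (0 : ℝ)..1, -((1 - t) ^ nbar / nbar.factorial) *
              ∑ γ : L → ↥B ⊕ ↥Ys, ursellOf (fun K' => slotMoment χ p ek B (fun b ω => Φ b (ext blk W ω)) c Ys
                (fun Y ω => V Y (ext blk W ω)) (fieldLaw blk Δ ℱ W) t K' γ) univ := by
  haveI := isProbabilityMeasure_fieldLaw blk Δ ℱ W hPD
  have hcz : ∀ b ∈ B, Continuous (Φ b) ∧ Φ b 0 = 0 := fun b hb => by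
    obtain ⟨ℓ₁, ℓ₂, h₁, h₂, h⟩ := hmod b hb
    exact continuous_and_zero_of_mod h₁ h₂ h
  have hz : ∀ t, zt χ p ek B (fun b ω => Φ b (ext blk W ω)) c Ys (fun Y ω => V Y (ext blk W ω)) (fieldLaw blk Δ ℱ W) t =
      zG blk Δ ℱ (fD (uD χ p ek B Φ c Ys V t) cube γ₀ ∅) W W := fun t =>
    zt_fieldLaw_eq_zG blk Δ ℱ W χ p ek B Φ c Ys V cube hcube γ₀ t
  have hzpos : ∀ t ∈ Set.Ioc (0 : ℝ) 1, 0 < zt χ p ek B (fun b ω => Φ b (ext blk W ω)) c Ys (fun Y ω => V Y (ext blk W ω))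
      (fieldLaw blk Δ ℱ W) t := fun t ht => by
    rw [hz]
    exact zG_fD_empty_pos blk Δ ℱ W χ cube hχ (by linarith) hPD hcube (fun b hb => (hcz b hb).1) (fun b hb => (hcz b hb).2) hc₀ hcb hV
      hK hek γ₀ ht.1 (BIJ88ZtPositivity308.mul_le_exp_neg_one_of_Ioc hek hek1.le ht)
  have h := effectiveAction_eq_pertP_add_remR_ursell_of_L1 χ (by linarith : 0 < p) (fieldLaw blk Δ ℱ W) (Φ := fun b ω => Φ b (ext blk W ω))
    (c := c) (Ys := Ys) (V := fun Y ω => V Y (ext blk W ω)) (fun b hb => ((hcz b hb).1.comp (continuous_ext blk W)).measurable) hc₀ hcb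
    (fun Y hY => (hV Y hY).comp (measurable_ext blk W)) (KY := KY) (fun Y hY ω => hK Y hY _) hek hek1 hzpos
    (slotFields_L1_mod blk Δ ℱ W χ hp hPD hmod hc₀ hcb hek) hL s₀
  simpa only [hz] using h

/-- **… WITH THE REMAINDER AS THE CONNECTED-GRAPH SERIES OF DISPLAY 3, MODULO (5.14.4)** — gen 12's `…_Tsum_of_ineq5144'` with `hlin` weakened to `hmod`
(hypotheses of the previous theorem plus `Δ` coupling abutting cubes only, cube-local fields and terms, and the typed leaf (5.14.4) for the prime-dropped
activities of every assignment at every `t ∈ (0,1]` in gen 5's regime). [cite: BalabanImbrieJaffe1988, (5.14.1)–(5.14.2) p.308; p.310 display 3; (5.14.4) p.309] -/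
theorem effectiveAction_fieldLaw_eq_pertP_add_remR_Tsum_of_ineq5144_mod (hR : ∀ x y, adj x y → adj y x) (hD : ∀ x, (nbr x).card ≤ D)
    (hnbr : ∀ x y, adj x y → y ∈ nbr x) (hθ0 : 0 < θ) (hθ1 : θ ≤ 1) (hβ : 0 ≤ β')
    (hsmall : 16 * ((D : ℝ) + 1) ^ 2 * (θ ^ (β' / 2) * Real.exp 2) ≤ 1) (hχ : ∀ x, 0 ≤ χ.χ₁ x) (hp : 1 / 2 < p)
    (hΔ : ∀ x y, blk x ≠ blk y → ¬ adj (blk x) (blk y) → Δ x y = 0) (hPD : (prec blk Δ W (corner ℝ W)).PosDef)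
    (hcube : ∀ τ, cube τ ∈ W)
    (hΦloc : ∀ b : B, ∀ φ ψ : α → ℝ, (∀ x, blk x = cube (Sum.inl b) → φ x = ψ x) → Φ b φ = Φ b ψ)
    (hVloc : ∀ Y : Ys, ∀ φ ψ : α → ℝ, (∀ x, blk x = cube (Sum.inr Y) → φ x = ψ x) → V Y φ = V Y ψ)
    (hmod : ∀ b ∈ B, ∃ ℓ₁ ℓ₂ : (α → ℝ) → ℝ, IsLinearMap ℝ ℓ₁ ∧ IsLinearMap ℝ ℓ₂ ∧
      ((∀ φ, Φ b φ = ℓ₁ φ) ∨ (∀ φ, Φ b φ = Real.sqrt (ℓ₁ φ ^ 2 + ℓ₂ φ ^ 2))))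
    {c₀ : ℝ} (hc₀ : 0 < c₀) (hcb : ∀ b ∈ B, c₀ ≤ c b) (hV : ∀ Y ∈ Ys, Measurable (V Y))
    {KY : υ → ℝ} (hK : ∀ Y ∈ Ys, ∀ φ, |V Y φ| ≤ KY Y) (hek : 0 < ek) (hek1 : ek < Real.exp (-1)) {nbar : ℕ}
    (hL : Fintype.card L = nbar + 1) (s₀ : ↥B ⊕ ↥Ys) (γ₀ : L → ↥B ⊕ ↥Ys)
    (h5144 : ∀ t ∈ Set.Ioc (0 : ℝ) 1, ∀ γ : L → ↥B ⊕ ↥Ys, Ineq5144 (cubeSys I) (Finset L)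
      (prime (g3 adj fun H' => zG blk Δ ℱ (fD (uD χ p ek B Φ c Ys V t) cube γ H')))
      Finset.card (fun H (X : Finset I) => (X \ H.image (cube ∘ γ)).card) θ β') :
    -Real.log (zG blk Δ ℱ (fD (uD χ p ek B Φ c Ys V 1) cube γ₀ ∅) W W) =
        pertP (fun t => Real.log (zG blk Δ ℱ (fD (uD χ p ek B Φ c Ys V t) cube γ₀ ∅) W W)) nbar
          + (nbar + 1 : ℝ) * remR (fun t => ∑ γ : L → ↥B ⊕ ↥Ys, Tsum ((polysOf W).image (cvsupp adj W)) (locv (cube ∘ γ))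
              (wv (prime (g3 adj fun H' => zG blk Δ ℱ (fD (uD χ p ek B Φ c Ys V t) cube γ H')))) univ) nbar ∧
      -Real.log (zG blk Δ ℱ (fD (uD χ p ek B Φ c Ys V 1) cube γ₀ ∅) W W) =
        pertP (fun t => Real.log (zG blk Δ ℱ (fD (uD χ p ek B Φ c Ys V t) cube γ₀ ∅) W W)) nbar
          + ∫ t in (0 : ℝ)..1, -((1 - t) ^ nbar / nbar.factorial) *
              ∑ γ : L → ↥B ⊕ ↥Ys, Tsum ((polysOf W).image (cvsupp adj W)) (locv (cube ∘ γ))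
                (wv (prime (g3 adj fun H' => zG blk Δ ℱ (fD (uD χ p ek B Φ c Ys V t) cube γ H')))) univ := by
  haveI : Nonempty L := Fintype.card_pos_iff.1 (by omega)
  obtain ⟨hA, -⟩ :=
    effectiveAction_fieldLaw_eq_pertP_add_remR_ursell_mod blk Δ ℱ W χ cube hχ hp hPD hcube hmod hc₀ hcb hV hK hek hek1 hL s₀ γ₀
  have hTs : ∀ t ∈ Set.Ioc (0 : ℝ) 1,
      ∑ γ : L → ↥B ⊕ ↥Ys, ursellOf (fun K' => slotMoment χ p ek B (fun b ω => Φ b (ext blk W ω)) c Ys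
          (fun Y ω => V Y (ext blk W ω)) (fieldLaw blk Δ ℱ W) t K' γ) univ =
        ∑ γ : L → ↥B ⊕ ↥Ys, Tsum ((polysOf W).image (cvsupp adj W)) (locv (cube ∘ γ))
          (wv (prime (g3 adj fun H' => zG blk Δ ℱ (fD (uD χ p ek B Φ c Ys V t) cube γ H')))) univ := fun t ht =>
    Finset.sum_congr rfl fun γ _ =>
      ursell_slotMoment_fieldLaw_eq_Tsum_of_ineq5144 blk Δ ℱ W adj χ cube hR hD hnbr hθ0 hθ1 hβ hsmall hΔ hcube hΦloc hVloc γ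
        (h5144 t ht γ) Finset.univ_nonempty
  have hA' := (remR_congr_Ioc hTs nbar) ▸ hA
  exact ⟨hA', by rw [← succ_mul_remR]; exact hA'⟩

/-- **THE REMAINDER OF (5.14.2) IS `O(|W|)` WITH THE `(n̄+1)`-ST POWER OF THE VERTEX FACTOR — linear-or-modulus slot fields, no centring, modulo (5.14.4)**:
under the hypotheses of the previous theorem, `|−log z₁ − 𝒫̃_{k+1}| ≤ (n̄+1)·N_s^{n̄+1}·θ^{(1−β′)(n̄+1)}·2·(2e²θ^{β′}(D+1))·|W|` (gen 11's
`BIJ88SlotConnectedGraph310KP.abs_remR_sum_Tsum_le_of_ineq5144`). [cite: BalabanImbrieJaffe1988, (5.14.2) p.308; p.310 (Sect. 5.14); (5.14.4) p.309] -/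
theorem abs_effectiveAction_sub_pertP_le_of_ineq5144_mod (hR : ∀ x y, adj x y → adj y x) (hD : ∀ x, (nbr x).card ≤ D)
    (hnbr : ∀ x y, adj x y → y ∈ nbr x) (hθ0 : 0 < θ) (hθ1 : θ ≤ 1) (hβ : 0 ≤ β')
    (hsmall : 16 * ((D : ℝ) + 1) ^ 2 * (θ ^ (β' / 2) * Real.exp 2) ≤ 1) (hχ : ∀ x, 0 ≤ χ.χ₁ x) (hp : 1 / 2 < p)
    (hΔ : ∀ x y, blk x ≠ blk y → ¬ adj (blk x) (blk y) → Δ x y = 0) (hPD : (prec blk Δ W (corner ℝ W)).PosDef)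
    (hcube : ∀ τ, cube τ ∈ W)
    (hΦloc : ∀ b : B, ∀ φ ψ : α → ℝ, (∀ x, blk x = cube (Sum.inl b) → φ x = ψ x) → Φ b φ = Φ b ψ)
    (hVloc : ∀ Y : Ys, ∀ φ ψ : α → ℝ, (∀ x, blk x = cube (Sum.inr Y) → φ x = ψ x) → V Y φ = V Y ψ)
    (hmod : ∀ b ∈ B, ∃ ℓ₁ ℓ₂ : (α → ℝ) → ℝ, IsLinearMap ℝ ℓ₁ ∧ IsLinearMap ℝ ℓ₂ ∧
      ((∀ φ, Φ b φ = ℓ₁ φ) ∨ (∀ φ, Φ b φ = Real.sqrt (ℓ₁ φ ^ 2 + ℓ₂ φ ^ 2))))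
    {c₀ : ℝ} (hc₀ : 0 < c₀) (hcb : ∀ b ∈ B, c₀ ≤ c b) (hV : ∀ Y ∈ Ys, Measurable (V Y))
    {KY : υ → ℝ} (hK : ∀ Y ∈ Ys, ∀ φ, |V Y φ| ≤ KY Y) (hek : 0 < ek) (hek1 : ek < Real.exp (-1)) {nbar : ℕ}
    (hL : Fintype.card L = nbar + 1) (s₀ : ↥B ⊕ ↥Ys) (γ₀ : L → ↥B ⊕ ↥Ys)
    (h5144 : ∀ t ∈ Set.Ioc (0 : ℝ) 1, ∀ γ : L → ↥B ⊕ ↥Ys, Ineq5144 (cubeSys I) (Finset L)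
      (prime (g3 adj fun H' => zG blk Δ ℱ (fD (uD χ p ek B Φ c Ys V t) cube γ H')))
      Finset.card (fun H (X : Finset I) => (X \ H.image (cube ∘ γ)).card) θ β') :
    |-Real.log (zG blk Δ ℱ (fD (uD χ p ek B Φ c Ys V 1) cube γ₀ ∅) W W) -
        pertP (fun t => Real.log (zG blk Δ ℱ (fD (uD χ p ek B Φ c Ys V t) cube γ₀ ∅) W W)) nbar| ≤
      (nbar + 1 : ℝ) * ((Fintype.card (L → ↥B ⊕ ↥Ys) : ℝ) *
        ((θ ^ (1 - β')) ^ (nbar + 1) * (2 * (2 * Real.exp 2 * θ ^ β' * ((D : ℝ) + 1)) * W.card))) := by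
  obtain ⟨hA, -⟩ := effectiveAction_fieldLaw_eq_pertP_add_remR_Tsum_of_ineq5144_mod blk Δ ℱ W χ adj cube hR hD hnbr hθ0 hθ1 hβ hsmall hχ
    hp hΔ hPD hcube hΦloc hVloc hmod hc₀ hcb hV hK hek hek1 hL s₀ γ₀ h5144
  have hb := abs_remR_sum_Tsum_le_of_ineq5144 blk Δ ℱ W adj χ cube hR hD hnbr hθ0 hθ1 hβ hsmall hL h5144
  rw [hA, add_sub_cancel_left, abs_mul, abs_of_nonneg (by positivity : (0 : ℝ) ≤ nbar + 1)]
  exact mul_le_mul_of_nonneg_left hb (by positivity)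

end Model

end Literature.MathematicalPhysics.QuantumFieldTheory.BalabanImbrieJaffe1984to88.BIJ88GaussShellModulus309

end
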